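import Summits.BirchSwinnertonDyer.Rank1Residual.O5.SupersingularLocalClassUniqueThreeTame
import Summits.BirchSwinnertonDyer.Rank1Residual.O5.GssTwistDictionary
import HarnessLib

/-!
# One local projective `3`-torsion class on ALL of O5 ∪ {good at 3}: the `I₀*`-supersingular rows
# by the `(−3)`-twist (cell `b2b-bsdres`, team n1011, row T-SSQ3 addendum A2, seat n1011-p05 GEN 11,
# FILE F5 — END)

HONEST FRAMING (cell `b2b-bsdres`, run/shared/lean/b2b/bsd-rank1-residual/, verbatim in every
file): the goal of the cell is to DELETE the COMBINATION-SHAPED residual classes of the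
Birch–Swinnerton-Dyer formula for ALL analytic-rank `≤ 1` elliptic curves over `ℚ` — "full BSD
formula for every rank `≤ 1` curve in class `C`" assembled STRICTLY from published theorems — so
that the rank-`≤ 1` remainder becomes exactly the CONSTRUCTION-SHAPED classes, which are TYPED
(missing-input `Prop`s), NOT attempted. This is not "finishing BSD". Team n1011; row T-SSQ3
(`cells/n1011/skel/T-SSQ3.md`), ADDENDUM A2. TOOL/END theorems only — no definition, no named fact,
no `sorry`; closes NO pair, moves NO mark (O5 OPEN); nothing booked.

## What

T19a (`O5.supersingularLocalClassUniqueThree_holds`, F3b) and its tame sharpening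
(`sameDivisionQuarticAtThree_of_subTprime_or_good`, F4b) cover good-at-`3`, `III` and `III*` curves.
The remaining half of `ClassO5` is `SubGss` (Kodaira `I₀*`, potentially SUPERSINGULAR: the
`(−3)`-twist has good supersingular reduction — the tree's SUPPLY theorem
`exists_goodSS_twist_pStar_of_classO5_of_subGss`, `O5/GssTwistDictionary.lean`). Since the roots of
`Ψ₃` of a quadratic twist `W^d` are `d` times those of `W` (`Ψ₃_quadraticTwist_comp`:
`Ψ₃^{W^d}(dX) = d⁴ · Ψ₃^W(X)`), rootlessness, irreducibility over `ℚ₃` and roots in `K₄` all pass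
between `W` and `W^d` (§1); so the good-supersingular case of F3b, applied to a globally minimal model
of `E^{(−3)}`, gives the Kummer shape of every `SubGss` curve (`kummerShape_of_subGss`), hence of all
of `ClassO5` (`kummerShape_of_classO5`), and the END

* `sameDivisionQuarticAtThree_of_classO5_or_good` — any two curves over `ℚ`, each in `ClassO5 · 3`
  (tame potentially supersingular at `3`: `I₀*`-ss, `III`, `III*`) or good at `3`, both with `Ψ₃`
  rootless over `ℚ₃`, satisfy `SameDivisionQuarticAtThree`: ONE local projective class,
  `ℚ₃(x(P)) ≅ ℚ₃(3^{1/4})`.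

References: J. H. Silverman, *AEC* X.2 (quadratic twists), Ex. 3.7 [SilvermanAEC2009]; D. Delbourgo,
Compositio 113 (1998) §1.5 (G) [Delbourgo1998]; cells/n1011/skel/T-SSQ3.md.
-/

noncomputable section

open scoped Classical

open Polynomial WeierstrassCurve Literature.NumberTheory.EllipticCurves
  Literature.NumberTheory.EllipticCurves.Rank1Residual
  Summit.BirchSwinnertonDyer.Rank1Residual.Additive
  Summit.BirchSwinnertonDyer.Rank1Residual.GaloisImage.QuarticKummerThree
  Summit.BirchSwinnertonDyer.Rank1Residual.GaloisImage.PsiThreeKummer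

namespace Summit.BirchSwinnertonDyer.Rank1Residual.O5

/-! ## §1 `Ψ₃` of a quadratic twist -/

section Twist

variable {F : Type*} [Field F] [NeZero (2 : F)] (W : WeierstrassCurve F) (d : F)

/-- **`Ψ₃` of a quadratic twist**: `Ψ₃^{W^d}(dX) = d⁴ · Ψ₃^W(X)` (the `b`'s of `W^d` are `d b₂, d² b₄,
d³ b₆, d⁴ b₈`). [cite: SilvermanAEC2009, X.2 (remark after Prop. 2.4) and Exercise 3.7] -/
theorem Ψ₃_quadraticTwist_comp :
    (W.quadraticTwist d).Ψ₃.comp (Polynomial.C d * X) = Polynomial.C (d ^ 4) * W.Ψ₃ := by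
  simp only [WeierstrassCurve.Ψ₃, quadraticTwist_b₂, quadraticTwist_b₄, quadraticTwist_b₆,
    quadraticTwist_b₈, add_comp, mul_comp, pow_comp, X_comp, C_comp, ofNat_comp, map_mul, map_pow]
  ring

variable {A : Type*} [CommRing A] [Algebra F A]

/-- A root `y` of `Ψ₃^W` in a field extension gives the root `d y` of `Ψ₃^{W^d}`. [folklore] -/
theorem aeval_Ψ₃_quadraticTwist_eq_zero {y : A} (hy : aeval y W.Ψ₃ = 0) :
    aeval (algebraMap F A d * y) (W.quadraticTwist d).Ψ₃ = 0 := by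
  have h := congrArg (aeval y) (Ψ₃_quadraticTwist_comp W d)
  simp only [aeval_comp, map_mul, map_pow, aeval_C, aeval_X, hy, mul_zero] at h
  exact h

/-- Conversely a root `x` of `Ψ₃^{W^d}` (`d ≠ 0`) gives the root `d⁻¹ x` of `Ψ₃^W` (in any
`F`-algebra: `d⁴` is a unit of `F`). [folklore] -/
theorem aeval_Ψ₃_eq_zero_of_quadraticTwist (hd : d ≠ 0) {x : A}
    (hx : aeval x (W.quadraticTwist d).Ψ₃ = 0) :
    aeval (algebraMap F A d⁻¹ * x) W.Ψ₃ = 0 := by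
  have h := congrArg (aeval (algebraMap F A d⁻¹ * x)) (Ψ₃_quadraticTwist_comp W d)
  simp only [aeval_comp, map_mul, map_pow, aeval_C, aeval_X] at h
  rw [← mul_assoc, ← map_mul, mul_inv_cancel₀ hd, map_one, one_mul, hx] at h
  -- `h : 0 = (algebraMap F A d) ^ 4 * aeval (d⁻¹ x) Ψ₃`
  have h1 : algebraMap F A (d⁻¹ ^ 4) * (algebraMap F A d ^ 4) = 1 := by
    rw [← map_pow, ← map_mul, ← map_one (algebraMap F A)]
    congr 1
    rw [← mul_pow, inv_mul_cancel₀ hd, one_pow]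
  calc aeval (algebraMap F A d⁻¹ * x) W.Ψ₃
      = algebraMap F A (d⁻¹ ^ 4) * (algebraMap F A d ^ 4 * aeval (algebraMap F A d⁻¹ * x) W.Ψ₃) := by
        rw [← mul_assoc, h1, one_mul]
    _ = 0 := by rw [← h, mul_zero]

/-- **Rootlessness of `Ψ₃` over the base field is twist-invariant** (`d ≠ 0`). [folklore] -/
theorem forall_not_isRoot_Ψ₃_quadraticTwist_iff (hd : d ≠ 0) :
    (∀ x : F, ¬ (W.quadraticTwist d).Ψ₃.IsRoot x) ↔ ∀ y : F, ¬ W.Ψ₃.IsRoot y := by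
  constructor
  · intro h y hy
    have := aeval_Ψ₃_quadraticTwist_eq_zero W d (A := F) (y := y) (by rwa [coe_aeval_eq_eval])
    rw [coe_aeval_eq_eval] at this
    exact h _ this
  · intro h x hx
    have := aeval_Ψ₃_eq_zero_of_quadraticTwist W d (A := F) hd (x := x)
      (by rwa [coe_aeval_eq_eval])
    rw [coe_aeval_eq_eval] at this
    exact h _ this

/-- **Irreducibility of `Ψ₃` over the base field is twist-invariant** (`d ≠ 0`): `X ↦ dX` is an
automorphism of `F[X]` and `d⁴` a unit. [folklore] -/
theorem irreducible_Ψ₃_quadraticTwist_iff (hd : d ≠ 0) :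
    Irreducible (W.quadraticTwist d).Ψ₃ ↔ Irreducible W.Ψ₃ := by
  letI : Invertible d := invertibleOfNonzero hd
  have hcomp : algEquivCMulXAddC d 0 (W.quadraticTwist d).Ψ₃ = Polynomial.C (d ^ 4) * W.Ψ₃ := by
    rw [algEquivCMulXAddC_apply, ← comp_eq_aeval, map_zero, add_zero, Ψ₃_quadraticTwist_comp]
  have hunit : IsUnit (Polynomial.C (d ^ 4)) := isUnit_C.mpr (pow_ne_zero _ hd).isUnit
  have key : Irreducible (algEquivCMulXAddC d 0 (W.quadraticTwist d).Ψ₃) ↔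
      Irreducible (W.quadraticTwist d).Ψ₃ := MulEquiv.irreducible_iff _
  rw [← key, hcomp, irreducible_isUnit_mul hunit]

end Twist

/-- **Quadratic twist commutes with base change** (`ℚ → ℚ₃`). [folklore] -/
theorem quadraticTwist_baseChange (W : WeierstrassCurve ℚ) (d : ℚ) :
    (W.quadraticTwist d).baseChange ℚ_[3] = (W.baseChange ℚ_[3]).quadraticTwist (d : ℚ_[3]) := by
  ext <;> simp [quadraticTwist, WeierstrassCurve.baseChange, WeierstrassCurve.map_b₂,
    WeierstrassCurve.map_b₄, WeierstrassCurve.map_b₆, map_div₀]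

/-! ## §2 The `I₀*`-supersingular rows and all of `ClassO5` -/

variable (E : WeierstrassCurve ℚ) [E.IsElliptic]

/-- **(G, by good reduction directly) At a good `3` with `Ψ₃` rootless over `ℚ₃`: the Kummer shape**
(F3b `kummerShape_of_not_dvd_conductorNorm` through `dvd_conductorNorm_iff_not_hasGoodReductionAtPrime`).
[folklore] -/
theorem kummerShape_of_hasGoodReductionAtPrime [Fact (Nat.Prime 3)] (hgood : E.HasGoodReductionAtPrime 3)
    (hroot : ∀ r : ℚ_[3], ¬ ((E.baseChange ℚ_[3]).Ψ₃).IsRoot r) :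
    Irreducible (E.baseChange ℚ_[3]).Ψ₃ ∧
      ∃ x : AdjoinRoot (X ^ 4 - Polynomial.C (3 : ℚ_[3])), aeval x (E.baseChange ℚ_[3]).Ψ₃ = 0 :=
  kummerShape_of_not_dvd_conductorNorm E
    (fun h ↦ (E.dvd_conductorNorm_iff_not_hasGoodReductionAtPrime 3).mp h hgood) hroot

variable [E.IsGloballyMinimal]

omit [E.IsElliptic] [E.IsGloballyMinimal] in
/-- **Transport through a quadratic twist with a good model**: if `C • E^{(d)} = Wd` over `ℚ` (`d ≠ 0`)
with `Wd` good at `3`, and `Ψ₃^E` is rootless over `ℚ₃`, then `Ψ₃^E` is irreducible over `ℚ₃` with a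
root in `K₄` (rootlessness passes to `Wd` by §1 + F2a; the good case of F3b applies to `Wd`; the shape
comes back along `Wd ⊗ ℚ₃ = C • (E ⊗ ℚ₃)^{(d)}`). [cite: SilvermanAEC2009, X.2] -/
theorem kummerShape_of_twist_good [Fact (Nat.Prime 3)] {d : ℚ} (hd : d ≠ 0) {C : VariableChange ℚ}
    {Wd : WeierstrassCurve ℚ} [Wd.IsElliptic] (hC : C • E.quadraticTwist d = Wd)
    (hgood : Wd.HasGoodReductionAtPrime 3)
    (hroot : ∀ r : ℚ_[3], ¬ ((E.baseChange ℚ_[3]).Ψ₃).IsRoot r) :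
    Irreducible (E.baseChange ℚ_[3]).Ψ₃ ∧
      ∃ x : AdjoinRoot (X ^ 4 - Polynomial.C (3 : ℚ_[3])), aeval x (E.baseChange ℚ_[3]).Ψ₃ = 0 := by
  have hd3 : (d : ℚ_[3]) ≠ 0 := Rat.cast_ne_zero.mpr hd
  -- `Wd ⊗ ℚ₃ = C' • (E ⊗ ℚ₃)^{(d)}`
  have hmodel : (C.map (algebraMap ℚ ℚ_[3])) • (E.baseChange ℚ_[3]).quadraticTwist (d : ℚ_[3]) =
      Wd.baseChange ℚ_[3] := by
    have h := congrArg (fun V : WeierstrassCurve ℚ ↦ V.baseChange ℚ_[3]) hC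
    rw [← h, ← quadraticTwist_baseChange, WeierstrassCurve.baseChange, WeierstrassCurve.baseChange,
      map_variableChange]
  -- rootlessness passes to `Wd`
  have hrootd : ∀ r : ℚ_[3], ¬ (((E.baseChange ℚ_[3]).quadraticTwist (d : ℚ_[3])).Ψ₃).IsRoot r :=
    (forall_not_isRoot_Ψ₃_quadraticTwist_iff (E.baseChange ℚ_[3]) (d : ℚ_[3]) hd3).mpr hroot
  have hrootWd : ∀ r : ℚ_[3], ¬ ((Wd.baseChange ℚ_[3]).Ψ₃).IsRoot r := by
    rw [← hmodel]
    exact (forall_not_isRoot_Ψ₃_smul_iff _ _).mpr hrootd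
  -- the good case on `Wd`, transported back
  obtain ⟨hirrWd, x, hx⟩ := kummerShape_of_hasGoodReductionAtPrime Wd hgood hrootWd
  rw [← hmodel] at hirrWd hx
  have hirrd := (irreducible_Ψ₃_smul_iff _ _).mp hirrWd
  have hxd := aeval_Ψ₃_eq_zero_of_smul _ _ hx
  exact ⟨(irreducible_Ψ₃_quadraticTwist_iff (E.baseChange ℚ_[3]) (d : ℚ_[3]) hd3).mp hirrd,
    ⟨_, aeval_Ψ₃_eq_zero_of_quadraticTwist (E.baseChange ℚ_[3]) (d : ℚ_[3]) hd3 hxd⟩⟩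

/-- **(G∧ss) On `SubGss` (Kodaira `I₀*`, potentially supersingular) with `Ψ₃` rootless over `ℚ₃`:
`Ψ₃^E` is irreducible over `ℚ₃` with a root in `K₄ = ℚ₃(3^{1/4})`** — a globally minimal model `Wd` of
the twist `E^{(−3)}` is good (supersingular) at `3` (tree SUPPLY theorem
`exists_goodSS_twist_pStar_of_classO5_of_subGss`), then `kummerShape_of_twist_good`.
[cite: SilvermanAEC2009, X.2 and VIII.8.3] [cite: Delbourgo1998, §1.5 (G)] -/
theorem kummerShape_of_subGss (h5 : ClassO5 E 3) (hG : SubGss E 3)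
    (hroot : ∀ r : ℚ_[3], ¬ ((E.baseChange ℚ_[3]).Ψ₃).IsRoot r) :
    Irreducible (E.baseChange ℚ_[3]).Ψ₃ ∧
      ∃ x : AdjoinRoot (X ^ 4 - Polynomial.C (3 : ℚ_[3])), aeval x (E.baseChange ℚ_[3]).Ψ₃ = 0 := by
  haveI : Fact (Nat.Prime 3) := ⟨Nat.prime_three⟩
  obtain ⟨Wd, hWdE, hWdM, C, hC, hSS⟩ := exists_goodSS_twist_pStar_of_classO5_of_subGss E 3 h5 hG
  haveI := hWdE
  exact kummerShape_of_twist_good E (pStar_ne_zero 3) hC hSS.1 hroot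

/-- **On ALL of `ClassO5 · 3`** (`SubGss ∨ SubTprime`) with `Ψ₃` rootless over `ℚ₃`: the Kummer shape.
[folklore] -/
theorem kummerShape_of_classO5 (h5 : ClassO5 E 3)
    (hroot : ∀ r : ℚ_[3], ¬ ((E.baseChange ℚ_[3]).Ψ₃).IsRoot r) :
    Irreducible (E.baseChange ℚ_[3]).Ψ₃ ∧
      ∃ x : AdjoinRoot (X ^ 4 - Polynomial.C (3 : ℚ_[3])), aeval x (E.baseChange ℚ_[3]).Ψ₃ = 0 := by
  rcases h5.2.2 with hG | ht
  · exact kummerShape_of_subGss E h5 hG hroot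
  · exact kummerShape_of_subTprime E h5 ht hroot

/-- **Per curve, final form**: on `ClassO5 · 3 ∨ 3 ∤ N` with `Ψ₃` rootless over `ℚ₃`, `Ψ₃^E` is
irreducible over `ℚ₃` with a root in `K₄` — `ℚ₃(x(P)) ≅ ℚ₃(3^{1/4})`. [folklore] -/
theorem kummerShape_of_classO5_or_good (hE : ClassO5 E 3 ∨ ¬ (3 ∣ E.conductorNorm ℤ))
    (hroot : ∀ r : ℚ_[3], ¬ ((E.baseChange ℚ_[3]).Ψ₃).IsRoot r) :
    Irreducible (E.baseChange ℚ_[3]).Ψ₃ ∧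
      ∃ x : AdjoinRoot (X ^ 4 - Polynomial.C (3 : ℚ_[3])), aeval x (E.baseChange ℚ_[3]).Ψ₃ = 0 := by
  rcases hE with h5 | hN
  · exact kummerShape_of_classO5 E h5 hroot
  · exact kummerShape_of_not_dvd_conductorNorm E hN hroot

/-! ## §3 END — one local projective `3`-torsion class on `ClassO5 ∪ {good at 3}` -/

/-- **T19a on the WHOLE tame potentially-supersingular class**: any two curves over `ℚ`, each in
`ClassO5 · 3` (Kodaira `I₀*`-ss, `III` or `III*` at `3`) or good at `3`, both with `Ψ₃` rootless over
`ℚ₃` (`E[3]|G_{ℚ₃}` irreducible), satisfy `SameDivisionQuarticAtThree` — `Ψ₃^E` is irreducible over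
`ℚ₃` and `Ψ₃^{E'}` has a root in `ℚ₃[X]/(Ψ₃^E)`: both quartics cut out `ℚ₃(3^{1/4})`.
[cite: SilvermanAEC2009, X.2; Exercise 3.7] [cite: SilvermanATAEC1994, IV.9.4 Steps 4, 6, 9] -/
theorem sameDivisionQuarticAtThree_of_classO5_or_good (E E' : WeierstrassCurve ℚ) [E.IsElliptic]
    [E.IsGloballyMinimal] [E'.IsElliptic] [E'.IsGloballyMinimal]
    (hE : ClassO5 E 3 ∨ ¬ (3 ∣ E.conductorNorm ℤ)) (hE' : ClassO5 E' 3 ∨ ¬ (3 ∣ E'.conductorNorm ℤ))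
    (hr : ∀ r : ℚ_[3], ¬ ((E.baseChange ℚ_[3]).Ψ₃).IsRoot r)
    (hr' : ∀ r : ℚ_[3], ¬ ((E'.baseChange ℚ_[3]).Ψ₃).IsRoot r) :
    SameDivisionQuarticAtThree E E' := by
  obtain ⟨hirr, x, hx⟩ := kummerShape_of_classO5_or_good E hE hr
  obtain ⟨-, x', hx'⟩ := kummerShape_of_classO5_or_good E' hE' hr'
  exact ⟨hirr, exists_aeval_eq_zero_of_roots_in_kummerField hirr
    ((E.baseChange ℚ_[3]).natDegree_Ψ₃ (by norm_num)) hx hx'⟩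

end Summit.BirchSwinnertonDyer.Rank1Residual.O5

end
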